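import Literature.Analysis.FluidPDE.GalerkinSmoothSolution
import Literature.Analysis.FluidPDE.GalerkinSmoothLimit
import Literature.Analysis.FluidPDE.GalerkinSmoothLimitODE
import Literature.Analysis.FluidPDE.FracNSLocalExistenceReduction
import Literature.Analysis.FluidPDE.FracLaplacianSmooth
import HarnessLib

/-!
# Short-time smooth solutions of the fractional Navier–Stokes equations on `T³` and
# De Rosa's gluing stage (De Rosa 2019, Thm. 3.4 / Prop. 3.5; §5.2)

L. De Rosa, *Infinitely many Leray–Hopf solutions for the fractional Navier–Stokes equations*,
Comm. PDE 44 (2019) 335–365 = arXiv:1801.10235. §3.2, Thm. 3.4: "for any `0 < α < 1` there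
exists a constant `c = c(α) > 0` with the following property. Given any initial data
`u₀ ∈ C^∞`, and `T ≤ c‖u₀‖_{1+α}⁻¹`, there exists a unique solution `v : 𝕋³ × [0,T] → ℝ³` of
(3.8)" [the fractional Navier–Stokes system `∂ₜv + (v·∇)v + ∇p + ν(-Δ)^γ v = 0`, `div v = 0`],
whose printed proof is the energy method of Majda–Bertozzi 2002, Thm. 3.4 (short-time existence
of smooth solutions with life span controlled by a high Sobolev norm of the datum) followed by
the a priori Hölder bounds of Prop. 3.5 and continuation.

This file (theorems only; no definitions, no named facts) closes the last gap of the tree's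
formalisation of De Rosa's gluing stage `DeRosa.gluingStage` (`DeRosaThreeStages.lean`): the
tree already reduces it (`DeRosa.gluingStage_of_shortTime`, `FracNSLocalExistenceReduction.lean`:
Cor. 5.2, Props. 5.3–5.5, the a priori estimate Prop. 3.5, forward uniqueness, restart and
gluing) to the **short-time existence statement** for smooth divergence-free data, and the
Fourier–Galerkin energy method is carried out on the Fourier side in `GalerkinSmoothHm.lean` …
`GalerkinSmoothSolution.lean` (`GalerkinSmooth.exists_galerkinLimit`,
`GalerkinSmooth.galerkinLimit_hasDerivWithinAt`, `GalerkinSmooth.synthesized_solution`, for the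
damped Galerkin systems with an arbitrary even nonnegative symbol `σ` of quadratic growth).
Here:

* `GalerkinSmooth.exists_latticeBound` — the lattice constant `∑_{k∈S} (1+|k|²)⁻² ≤ B` of the
  energy method in dimension `≤ 3` (product trick with `∑_j (1+j²)^{-2/3} < ∞`);
* `GalerkinSmooth.exists_sobolevSum_le` — the Sobolev sums `∑_{k∈S}(1+|k|²)ᵐ|û₀(k)|²` of a smooth
  datum are bounded for every `m`;
* `Torus.fracLaplacian_apply_eq_re_tsum` — the components of the spectral fractional Laplacian,
  `((-Δ)^γ w)_l(x) = Re ∑ₖ (4π²|k|²)^γ ŵ(k)_l e_k(x)`, identifying the Fourier-side damping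
  `σ_k = ν(4π²|k|²)^γ` of the Galerkin files with `ν(-Δ)^γ`;
* `Torus.exists_fracNS_smooth_of_sobolevBound` — **Majda–Bertozzi Thm. 3.4 for the fractional
  Navier–Stokes equations on `T^d`, `d ≤ 3`**: for `0 ≤ γ ≤ 1`, `ν ≥ 0`, a smooth divergence-free
  datum `u₀` with `∑(1+|k|²)⁴|û₀(k)|² ≤ M` and `T c(d,B)√M ≤ 1` there is a smooth solution
  `(v, p)` of `∂ₜv + (v·∇)v + ∇p + ν(-Δ)^γ v = 0`, `div v = 0` on `[0,T] × T^d`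
  (`Torus.IsFracNSReynoldsOn` with zero stress) with `v(0) = u₀` and `∫ p(t) = 0` — the velocity
  `v_l = Re ∑ₖ c(t)_{k,l} e_k` and pressure synthesized from the Galerkin limit;
* `Torus.fracNS_shortTime_smooth` — the same on `T³` with the life span expressed through
  `‖u₀‖_{C^{4,α}} ≤ M` (`Torus.sum_weight_four_sq_norm_mFourierCoeff_le`), i.e. exactly the
  short-time existence hypothesis of `DeRosa.gluingStage_of_shortTime`;
* `DeRosa.gluingStage_holds` — **De Rosa's gluing stage** (§5.2: Cor. 5.2, Props. 5.3–5.5 with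
  the local theory of §3.2), discharging the named fact `DeRosa.gluingStage`.

## References

* L. De Rosa, Comm. PDE 44 (2019) 335–365 = arXiv:1801.10235, §3.2 Thm. 3.4, Prop. 3.5; §5.2
  Cor. 5.2, Props. 5.3, 5.4, 5.5. [`Derosa2018`]
* A. J. Majda, A. L. Bertozzi, *Vorticity and Incompressible Flow*, CUP 2002, §3.2.2, Thm. 3.4
  and its proof (pp. 104–110). [`MajdaBertozziCUP2002`]
-/

noncomputable section

open MeasureTheory Set Filter Topology Function UnitAddTorus Metric Complex
open scoped ENNReal NNReal InnerProductSpace ContDiff ComplexConjugate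

namespace Literature.Analysis.FluidPDE

open FunctionSpaces FunctionSpaces.Torus Torus EulerGalerkin
open FourierNS (HasDecay)
open ScalarFourier (transportSym latOrder)

variable {d : Type*} [Fintype d] [DecidableEq d]

/-! ## The lattice constant in dimension `≤ 3` -/

namespace GalerkinSmooth

omit [Fintype d] [DecidableEq d] in
/-- `∑_{j∈ℤ} (1+j²)^{-2/3} < ∞` (comparison with the `p`-series `∑ |j|^{-4/3}`). [folklore] -/
theorem summable_inv_rpow_one_add_sq_int :
    Summable fun j : ℤ => ((1 + (j : ℝ) ^ 2) ^ (2 / 3 : ℝ))⁻¹ := by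
  have h1 : Summable fun j : ℤ => |(j : ℝ)| ^ (-(4 / 3 : ℝ)) := Real.summable_abs_int_rpow (by norm_num)
  have h0 : Summable (fun j : ℤ => if j = 0 then (1 : ℝ) else 0) :=
    summable_of_ne_finset_zero (s := {0}) fun j hj => by
      rw [Finset.mem_singleton] at hj
      rw [if_neg hj]
  refine Summable.of_nonneg_of_le (fun j => by positivity) (fun j => ?_) (h1.add h0)
  by_cases hj : j = 0
  · subst hj
    have h2 : |((0 : ℤ) : ℝ)| ^ (-(4 / 3 : ℝ)) = 0 := by
      rw [Int.cast_zero, abs_zero, Real.zero_rpow (by norm_num)]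
    rw [h2, if_pos rfl, Int.cast_zero]
    norm_num
  · rw [if_neg hj, add_zero]
    have hpos : 0 < |(j : ℝ)| := abs_pos.2 (Int.cast_ne_zero.2 hj)
    rw [Real.rpow_neg hpos.le]
    refine inv_anti₀ (Real.rpow_pos_of_pos hpos _) ?_
    calc |(j : ℝ)| ^ (4 / 3 : ℝ) = (|(j : ℝ)| ^ 2) ^ (2 / 3 : ℝ) := by
          rw [← Real.rpow_natCast, ← Real.rpow_mul hpos.le]; norm_num
      _ ≤ (1 + (j : ℝ) ^ 2) ^ (2 / 3 : ℝ) :=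
          Real.rpow_le_rpow (by positivity) (by rw [sq_abs]; linarith) (by norm_num)

omit [DecidableEq d] in
/-- **The lattice constant of the energy method in dimension `≤ 3`**:
`∑_{k ∈ S} (1 + |k|²)⁻² ≤ B := ∑_{k ∈ ℤ^d} ∏ᵢ (1 + kᵢ²)^{-2/3} < ∞` for every finite `S ⊆ ℤ^d`,
`#d ≤ 3` (since `∏ᵢ (1 + kᵢ²)^{2/3} ≤ (1 + |k|²)^{2#d/3} ≤ (1 + |k|²)²`). [folklore] -/
theorem exists_latticeBound (hd : Fintype.card d ≤ 3) :
    ∃ B : ℝ, ∀ S : Finset (d → ℤ), ∑ k ∈ S, ((1 + freqNormSq k) ^ 2)⁻¹ ≤ B := by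
  set g : (d → ℤ) → ℝ := fun k => ∏ i, ((1 + ((k i : ℤ) : ℝ) ^ 2) ^ (2 / 3 : ℝ))⁻¹ with hg_def
  have hg : Summable g :=
    summable_pi_prod_of_summable (a := fun j : ℤ => ((1 + (j : ℝ) ^ 2) ^ (2 / 3 : ℝ))⁻¹)
      (fun j => by positivity) summable_inv_rpow_one_add_sq_int
  have hg0 : ∀ k, 0 ≤ g k := fun k => Finset.prod_nonneg fun i _ => by positivity
  refine ⟨∑' k, g k, fun S => ?_⟩
  have hle : ∀ k, ((1 + freqNormSq k) ^ 2)⁻¹ ≤ g k := by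
    intro k
    have hq : 1 ≤ 1 + freqNormSq k := by linarith [freqNormSq_nonneg k]
    rw [hg_def]
    dsimp only
    rw [Finset.prod_inv_distrib]
    refine inv_anti₀ (Finset.prod_pos fun i _ => by positivity) ?_
    calc ∏ i, (1 + ((k i : ℤ) : ℝ) ^ 2) ^ (2 / 3 : ℝ) ≤ ∏ _i : d, (1 + freqNormSq k) ^ (2 / 3 : ℝ) := by
          refine Finset.prod_le_prod (fun i _ => by positivity) fun i _ => ?_
          refine Real.rpow_le_rpow (by positivity) ?_ (by norm_num)
          have : ((k i : ℤ) : ℝ) ^ 2 ≤ freqNormSq k :=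
            Finset.single_le_sum (f := fun j => ((k j : ℤ) : ℝ) ^ 2) (fun j _ => sq_nonneg _)
              (Finset.mem_univ i)
          linarith
      _ = (1 + freqNormSq k) ^ ((2 / 3 : ℝ) * Fintype.card d) := by
          rw [Finset.prod_const, Finset.card_univ, ← Real.rpow_natCast,
            ← Real.rpow_mul (by linarith)]
      _ ≤ (1 + freqNormSq k) ^ (2 : ℝ) := by
          refine Real.rpow_le_rpow_of_exponent_le hq ?_
          have : (Fintype.card d : ℝ) ≤ 3 := by exact_mod_cast hd
          nlinarith
      _ = (1 + freqNormSq k) ^ 2 := by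
          rw [← Real.rpow_natCast]; norm_num
  calc ∑ k ∈ S, ((1 + freqNormSq k) ^ 2)⁻¹ ≤ ∑ k ∈ S, g k := Finset.sum_le_sum fun k _ => hle k
    _ ≤ ∑' k, g k := hg.sum_le_tsum S fun k _ => hg0 k

/-! ## Sobolev sums of a smooth datum -/

/-- **The Sobolev sums of a smooth datum are finite at every order**:
`∑_{k ∈ S} (1 + |k|²)ᵐ ‖û₀(k)‖² ≤ U_m` for all finite `S` (coefficients of smooth fields decay
faster than any polynomial, `Torus.norm_mFourierCoeff_le_of_iterate_bound`; Grafakos 2014,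
§3.3.1). [folklore] -/
theorem exists_sobolevSum_le {u₀ : UnitAddTorus d → EuclideanSpace ℝ d} (hu₀ : IsSmooth u₀) (m : ℕ) :
    ∃ U : ℝ, ∀ S : Finset (d → ℤ),
      ∑ k ∈ S, (1 + freqNormSq k) ^ m * ‖mFourierCoeff (EuclideanSpace.complexify ∘ u₀) k‖ ^ 2 ≤ U := by
  obtain ⟨K, hK0, hK⟩ := exists_iterate_bound hu₀ (m + Fintype.card d)
  set Z : ℝ := ∑' k : d → ℤ, ((1 + freqNormSq k) ^ Fintype.card d)⁻¹ with hZ_def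
  refine ⟨K ^ 2 * Z, fun S => ?_⟩
  have hterm : ∀ k, (1 + freqNormSq k) ^ m * ‖mFourierCoeff (EuclideanSpace.complexify ∘ u₀) k‖ ^ 2 ≤
      K ^ 2 * ((1 + freqNormSq k) ^ Fintype.card d)⁻¹ := by
    intro k
    have hq : 1 ≤ 1 + freqNormSq k := by linarith [freqNormSq_nonneg k]
    have h1 := norm_mFourierCoeff_le_of_iterate_bound hu₀ hK k
    have h2 : ‖mFourierCoeff (EuclideanSpace.complexify ∘ u₀) k‖ ^ 2 ≤
        (K * ((1 + freqNormSq k) ^ (m + Fintype.card d))⁻¹) ^ 2 :=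
      pow_le_pow_left₀ (norm_nonneg _) h1 2
    have hA : ((1 + freqNormSq k) ^ m)⁻¹ ≤ 1 := inv_le_one_of_one_le₀ (one_le_pow₀ hq)
    have hB : ((1 + freqNormSq k) ^ Fintype.card d)⁻¹ ≤ 1 := inv_le_one_of_one_le₀ (one_le_pow₀ hq)
    have hX : ((1 + freqNormSq k) ^ (m + Fintype.card d))⁻¹ =
        ((1 + freqNormSq k) ^ m)⁻¹ * ((1 + freqNormSq k) ^ Fintype.card d)⁻¹ := by
      rw [pow_add, mul_inv]
    have hmA : (1 + freqNormSq k) ^ m * ((1 + freqNormSq k) ^ m)⁻¹ = 1 :=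
      mul_inv_cancel₀ (by positivity)
    calc (1 + freqNormSq k) ^ m * ‖mFourierCoeff (EuclideanSpace.complexify ∘ u₀) k‖ ^ 2
        ≤ (1 + freqNormSq k) ^ m * (K * ((1 + freqNormSq k) ^ (m + Fintype.card d))⁻¹) ^ 2 :=
          mul_le_mul_of_nonneg_left h2 (by positivity)
      _ = K ^ 2 * (((1 + freqNormSq k) ^ m * ((1 + freqNormSq k) ^ m)⁻¹) *
            ((1 + freqNormSq k) ^ Fintype.card d)⁻¹ *
            (((1 + freqNormSq k) ^ m)⁻¹ * ((1 + freqNormSq k) ^ Fintype.card d)⁻¹)) := by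
          rw [hX]; ring
      _ ≤ K ^ 2 * (1 * ((1 + freqNormSq k) ^ Fintype.card d)⁻¹ * 1) := by
          rw [hmA]
          refine mul_le_mul_of_nonneg_left ?_ (sq_nonneg _)
          refine mul_le_mul_of_nonneg_left (mul_le_one₀ hA (by positivity) hB) (by positivity)
      _ = K ^ 2 * ((1 + freqNormSq k) ^ Fintype.card d)⁻¹ := by ring
  calc ∑ k ∈ S, (1 + freqNormSq k) ^ m * ‖mFourierCoeff (EuclideanSpace.complexify ∘ u₀) k‖ ^ 2
      ≤ ∑ k ∈ S, K ^ 2 * ((1 + freqNormSq k) ^ Fintype.card d)⁻¹ := Finset.sum_le_sum fun k _ => hterm k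
    _ = K ^ 2 * ∑ k ∈ S, ((1 + freqNormSq k) ^ Fintype.card d)⁻¹ := by rw [Finset.mul_sum]
    _ ≤ K ^ 2 * Z := by
        refine mul_le_mul_of_nonneg_left ?_ (sq_nonneg _)
        exact summable_inv_one_add_freqNormSq_pow_card.sum_le_tsum S fun k _ =>
          inv_nonneg.2 (pow_nonneg (by linarith [freqNormSq_nonneg k]) _)

omit [DecidableEq d] in
/-- **Quadratic growth of the fractional symbol**: `ν(4π²|k|²)^γ ≤ ν(1 + 4π²#d)(1 + ‖k‖)²` for
`0 ≤ γ ≤ 1`, `ν ≥ 0` (`x^γ ≤ 1 + x` and `|k|² ≤ #d ‖k‖²_∞`). [folklore] -/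
theorem fracSymbol_le_growth {γ : ℝ} (hγ0 : 0 ≤ γ) (hγ1 : γ ≤ 1) {ν : ℝ} (hν : 0 ≤ ν) (k : d → ℤ) :
    ν * fracSymbol γ k ≤ ν * (1 + 4 * Real.pi ^ 2 * Fintype.card d) * (1 + ‖k‖) ^ 2 := by
  have hq0 : 0 ≤ freqNormSq k := freqNormSq_nonneg k
  have hx0 : 0 ≤ 4 * Real.pi ^ 2 * freqNormSq k := by positivity
  have h1 : fracSymbol γ k ≤ 1 + 4 * Real.pi ^ 2 * freqNormSq k := by
    unfold fracSymbol
    rcases le_or_gt 1 (4 * Real.pi ^ 2 * freqNormSq k) with hx | hx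
    · calc (4 * Real.pi ^ 2 * freqNormSq k) ^ γ ≤ (4 * Real.pi ^ 2 * freqNormSq k) ^ (1 : ℝ) :=
            Real.rpow_le_rpow_of_exponent_le hx hγ1
        _ = 4 * Real.pi ^ 2 * freqNormSq k := Real.rpow_one _
        _ ≤ 1 + 4 * Real.pi ^ 2 * freqNormSq k := by linarith
    · calc (4 * Real.pi ^ 2 * freqNormSq k) ^ γ ≤ 1 := Real.rpow_le_one hx0 hx.le hγ0
        _ ≤ 1 + 4 * Real.pi ^ 2 * freqNormSq k := by linarith
  have h2 : freqNormSq k ≤ Fintype.card d * ‖k‖ ^ 2 := ScalarFourier.freqNormSq_le_card_mul k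
  have h3 : 1 + 4 * Real.pi ^ 2 * freqNormSq k ≤ (1 + 4 * Real.pi ^ 2 * Fintype.card d) * (1 + ‖k‖) ^ 2 := by
    have hk : 0 ≤ ‖k‖ := norm_nonneg k
    have hsq : ‖k‖ ^ 2 ≤ (1 + ‖k‖) ^ 2 := by nlinarith
    have hone : (1 : ℝ) ≤ (1 + ‖k‖) ^ 2 := by nlinarith
    have hπ : 0 ≤ 4 * Real.pi ^ 2 * (Fintype.card d : ℝ) := by positivity
    calc 1 + 4 * Real.pi ^ 2 * freqNormSq k ≤ 1 + 4 * Real.pi ^ 2 * (Fintype.card d * ‖k‖ ^ 2) := by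
          nlinarith [Real.pi_pos]
      _ ≤ (1 + ‖k‖) ^ 2 + 4 * Real.pi ^ 2 * Fintype.card d * (1 + ‖k‖) ^ 2 := by
          nlinarith [mul_le_mul_of_nonneg_left hsq hπ]
      _ = (1 + 4 * Real.pi ^ 2 * Fintype.card d) * (1 + ‖k‖) ^ 2 := by ring
  calc ν * fracSymbol γ k ≤ ν * (1 + 4 * Real.pi ^ 2 * freqNormSq k) := mul_le_mul_of_nonneg_left h1 hν
    _ ≤ ν * ((1 + 4 * Real.pi ^ 2 * Fintype.card d) * (1 + ‖k‖) ^ 2) := mul_le_mul_of_nonneg_left h3 hν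
    _ = ν * (1 + 4 * Real.pi ^ 2 * Fintype.card d) * (1 + ‖k‖) ^ 2 := by ring

end GalerkinSmooth

/-! ## Components of the spectral fractional Laplacian -/

namespace Torus

/-- **Components of the fractional Laplacian**: for smooth `w : T^d → ℝ^d` and `γ ≥ 0`,
`((-Δ)^γ w)(x)_l = Re ∑ₖ (4π²|k|²)^γ ŵ(k)_l e_k(x)` (the defining absolutely convergent series,
`Torus.fracLaplacian_def`, evaluated coordinatewise). [folklore] -/
theorem fracLaplacian_apply_eq_re_tsum {γ : ℝ} (hγ : 0 ≤ γ) {w : UnitAddTorus d → EuclideanSpace ℝ d}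
    (hw : FunctionSpaces.Torus.IsSmooth w) (x : UnitAddTorus d) (l : d) :
    fracLaplacian γ w x l =
      (∑' m : d → ℤ, ((fracSymbol γ m : ℝ) : ℂ) * mFourierCoeff (EuclideanSpace.complexify ∘ w) m l *
        mFourier m x).re := by
  have hs := summable_fracSymbol_smul_mFourier_smul hγ hw x
  have hf : (fun m : d → ℤ => ((fracSymbol γ m : ℝ) : ℂ) * mFourierCoeff (EuclideanSpace.complexify ∘ w) m l *
      mFourier m x) =
      fun m => (fracSymbol γ m • (mFourier m x • mFourierCoeff (EuclideanSpace.complexify ∘ w) m)) l := by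
    funext m
    rw [PiLp.smul_apply, PiLp.smul_apply, smul_eq_mul, Complex.real_smul]
    ring
  rw [hf, fracLaplacian_def, EuclideanSpace.realPart_apply]
  congr 1
  have h := (EuclideanSpace.proj l : EuclideanSpace ℂ d →L[ℂ] ℂ).map_tsum hs
  simpa using h

/-! ## Majda–Bertozzi Thm. 3.4 for the fractional Navier–Stokes equations on the torus -/

set_option maxHeartbeats 1600000 in
/-- **Short-time smooth solutions of the fractional Navier–Stokes equations from the Galerkin
limit** (Majda–Bertozzi 2002, Thm. 3.4, by the Fourier–Galerkin energy method of
`GalerkinSmoothHm.lean` … `GalerkinSmoothSolution.lean`; De Rosa 2019, Thm. 3.4). Let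
`0 ≤ γ ≤ 1`, `ν ≥ 0`, let `u₀ : T^d → ℝ^d` be smooth and FunctionSpaces.Torus.divergence free with
`∑_{k∈S} (1+|k|²)⁴ ‖û₀(k)‖² ≤ M` for all finite `S`, let `∑_{k∈S} (1+|k|²)⁻² ≤ B` (`d ≤ 3`), and
let `T > 0` obey the life-span condition `T c(d,B) √M ≤ 1` of `GalerkinSmooth.exists_galerkinLimit`.
Then there is a smooth solution `(v, p)` of `∂ₜv + (v·∇)v + ∇p + ν(-Δ)^γ v = 0`, `div v = 0` on
`[0, T] × T^d` (`Torus.IsFracNSReynoldsOn` with zero Reynolds stress) with `v(0) = u₀` and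
`∫ p(t) = 0`: the fields `v_l = Re ∑ₖ c(t)_{k,l} e_k`, `p = Re ∑ₖ p̂(t)_k e_k` synthesized from the
Galerkin limit `c` of the systems damped by `σ_k = ν(4π²|k|²)^γ`
(`GalerkinSmooth.synthesized_solution`), the damping term being `ν(-Δ)^γ v`
(`Torus.fracLaplacian_apply_eq_re_tsum`) and the datum recovered by Fourier inversion.
[cite: MajdaBertozziCUP2002, Thm. 3.4; Derosa2018, §3.2 Thm. 3.4] -/
theorem exists_fracNS_smooth_of_sobolevBound {B : ℝ}
    (hB : ∀ S : Finset (d → ℤ), ∑ k ∈ S, ((1 + freqNormSq k) ^ 2)⁻¹ ≤ B)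
    {γ : ℝ} (hγ0 : 0 ≤ γ) (hγ1 : γ ≤ 1) {ν : ℝ} (hν : 0 ≤ ν)
    {u₀ : UnitAddTorus d → EuclideanSpace ℝ d} (hu₀ : FunctionSpaces.Torus.IsSmooth u₀) (hdiv : FunctionSpaces.Torus.IsDivFree u₀)
    {M : ℝ} (hM : 0 < M)
    (hMu : ∀ S : Finset (d → ℤ),
      ∑ k ∈ S, (1 + freqNormSq k) ^ 4 * ‖mFourierCoeff (EuclideanSpace.complexify ∘ u₀) k‖ ^ 2 ≤ M)
    {T : ℝ} (hT : 0 < T)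
    (hTM : T * (((Fintype.card d * (2 * (2 ^ 4 * (Fintype.card d * Real.sqrt B * (2 * Real.pi) ^ (2 * 4 + 1)))) *
          (((Fintype.card d : ℝ) + 1) ^ 3 * Real.sqrt (((Fintype.card d : ℝ) + 1) ^ 3)) + 1) *
          Real.sqrt (1 + Fintype.card d * (2 * Real.pi) ^ (2 * 4))) * Real.sqrt M) ≤ 1) :
    ∃ (v : ℝ → UnitAddTorus d → EuclideanSpace ℝ d) (p : ℝ → UnitAddTorus d → ℝ),
      IsFracNSReynoldsOn (Icc 0 T) γ ν v p (fun _ _ _ => 0) ∧ v 0 = u₀ ∧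
        ∀ t ∈ Icc 0 T, FunctionSpaces.Torus.HasZeroMean (p t) := by
  have hS : UniqueDiffOn ℝ (Icc 0 T) := uniqueDiffOn_Icc hT
  -- the datum on the Fourier side
  set a : (d → ℤ) → EuclideanSpace ℂ d := fun k => mFourierCoeff (EuclideanSpace.complexify ∘ u₀) k with ha_def
  have ha : IsConjSymm a := isConjSymm_mFourierCoeff hu₀.integrable
  have haT : ∀ k : d → ℤ, ∑ j, (k j : ℂ) * a k j = 0 := fun k => hdiv.sum_mul_mFourierCoeff_eq_zero hu₀ k
  -- Sobolev sums of all orders, the fourth one bounded by `M`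
  have hUex : ∀ m : ℕ, ∃ U : ℝ, ∀ S : Finset (d → ℤ), ∑ k ∈ S, (1 + freqNormSq k) ^ m * ‖a k‖ ^ 2 ≤ U :=
    fun m => GalerkinSmooth.exists_sobolevSum_le hu₀ m
  choose U hU using hUex
  set U' : ℕ → ℝ := Function.update U 4 M with hU'_def
  have hU' : ∀ (m : ℕ) (S : Finset (d → ℤ)), ∑ k ∈ S, (1 + freqNormSq k) ^ m * ‖a k‖ ^ 2 ≤ U' m := by
    intro m S
    by_cases hm : m = 4
    · subst hm
      rw [hU'_def, Function.update_self]
      exact hMu S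
    · rw [hU'_def, Function.update_of_ne hm]
      exact hU m S
  have hMU : U' 4 ≤ M := by rw [hU'_def, Function.update_self]
  -- the damping symbol
  set σ : (d → ℤ) → ℝ := fun k => ν * fracSymbol γ k with hσ_def
  have hσ : ∀ k, 0 ≤ σ k := fun k => mul_nonneg hν (fracSymbol_nonneg γ k)
  have hσe : ∀ k, σ (-k) = σ k := fun k => by
    simp only [hσ_def, fracSymbol, freqNormSq_neg]
  set Mσ : ℝ := ν * (1 + 4 * Real.pi ^ 2 * Fintype.card d) with hMσ_def
  have hMσ : 0 ≤ Mσ := by rw [hMσ_def]; positivity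
  have hσg : ∀ k, σ k ≤ Mσ * (1 + ‖k‖) ^ 2 := fun k => GalerkinSmooth.fracSymbol_le_growth hγ0 hγ1 hν k
  -- the Galerkin limit
  obtain ⟨β, c, R, η, -, -, hβcont, hβderiv, -, hR, -, hηt, herr, hc0, hconj, htrans, hcbound, hccont⟩ :=
    GalerkinSmooth.exists_galerkinLimit hB (ν := 0) le_rfl hσ hσe ha haT hU' hM hMU hT.le hTM
  -- its differential equation, mode by mode
  have hode : ∀ k, ∀ t ∈ Icc 0 T, HasDerivWithinAt (fun s => c s k)
      (-(((((0 : ℝ) * (4 * Real.pi ^ 2 * freqNormSq k)) : ℝ) : ℂ) • c t k) +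
        leraySym k (-((((σ k) : ℝ)) : ℂ) • c t k -
          WithLp.toLp 2 (fun p => transportSym (fun j m => c t m j) (fun m => c t m p) k))) (Icc 0 T) t :=
    fun k t ht => GalerkinSmooth.galerkinLimit_hasDerivWithinAt (ν := 0) le_rfl hσ hT.le hβcont
      (fun n => hβderiv n T) hR hηt herr hcbound hccont k ht
  -- decay of all orders
  have hdec : ∀ K : ℕ, ∃ C : ℝ, ∀ t ∈ Icc 0 T, HasDecay K C (c t) := fun K =>
    ⟨2 ^ K * Real.sqrt (R (2 * K)), fun t ht =>
      (GalerkinSmooth.hasDecay_of_forall_sum_le (fun m F => hcbound m t ht F) K).of_le (by omega)⟩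
  -- the synthesized solution
  obtain ⟨θ, q, hθs, hqs, hmom, hdivθ, hq0, hcoef⟩ :=
    GalerkinSmooth.synthesized_solution hT (ν := 0) le_rfl hσ hMσ hσg hconj htrans hdec hccont hode
  -- the velocity field
  set v : ℝ → UnitAddTorus d → EuclideanSpace ℝ d := fun t x => WithLp.toLp 2 (fun l => θ l t x) with hv_def
  have hv_apply : ∀ t x l, v t x l = θ l t x := fun t x l => rfl
  have hvs : FunctionSpaces.Torus.IsSmoothSpaceTimeOn (Icc 0 T) v := by
    unfold FunctionSpaces.Torus.IsSmoothSpaceTimeOn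
    exact (contDiffOn_piLp 2).2 fun l => hθs l
  have hvt : ∀ t ∈ Icc 0 T, FunctionSpaces.Torus.IsSmooth (v t) := fun t ht => hvs.isSmooth_slice ht
  -- summability of the coefficients and the Fourier coefficients of the velocity
  obtain ⟨Cc, hCc⟩ := hdec (latOrder d)
  have hsuml : ∀ t ∈ Icc 0 T, ∀ l, Summable fun m => ‖c t m l‖ := fun t ht l =>
    ScalarFourier.summable_norm_of_hasDecay le_rfl (GalerkinSmooth.hasDecay_apply (hCc t ht) l)
  have hcoefv : ∀ t ∈ Icc 0 T, ∀ m l, mFourierCoeff (EuclideanSpace.complexify ∘ v t) m l = c t m l := by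
    intro t ht m l
    rw [mFourierCoeff_complexify_apply (hvt t ht).integrable]
    have h1 : (fun x => ((v t x l : ℝ) : ℂ)) = fun x => ∑' m', c t m' l * mFourier m' x :=
      funext fun x => hcoef t ht x l
    rw [h1]
    exact ScalarFourier.mFourierCoeff_tsum_mul_mFourier (hsuml t ht l) m
  refine ⟨v, q, ⟨hvs, hqs, contDiffOn_const, fun t ht x => ?_, fun t ht x => ?_, fun _ _ _ _ _ => rfl⟩, ?_, hq0⟩
  · -- the momentum equation, component by component
    have hvt' : FunctionSpaces.Torus.IsSmooth (v t) := hvt t ht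
    have hv1 : IsContDiff 1 (v t) := hvt'.isContDiff (by simp)
    have hqt : FunctionSpaces.Torus.IsSmooth (q t) := hqs.isSmooth_slice ht
    rw [tensorDivergence_zero]
    ext l
    rw [PiLp.add_apply, PiLp.add_apply, PiLp.add_apply, PiLp.smul_apply, PiLp.zero_apply, smul_eq_mul]
    -- time derivative
    have h1 : FunctionSpaces.Torus.timeDerivWithin (Icc 0 T) v t x l = FunctionSpaces.Torus.timeDerivWithin (Icc 0 T) (θ l) t x := by
      have hd : HasDerivWithinAt (fun τ => v τ x l) (FunctionSpaces.Torus.timeDerivWithin (Icc 0 T) v t x l) (Icc 0 T) t :=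
        ((EuclideanSpace.proj l : EuclideanSpace ℝ d →L[ℝ] ℝ).hasFDerivAt.comp_hasDerivWithinAt t
          (hvs.hasDerivWithinAt_slice ht x))
      exact (hd.derivWithin (hS t ht)).symm
    -- convection
    have h2 : FunctionSpaces.Torus.convect (v t) (v t) x l = ∑ j, θ j t x * FunctionSpaces.Torus.partialDeriv j (θ l t) x := by
      rw [FunctionSpaces.Torus.convect, FunctionSpaces.Torus.fderiv_apply_eq_sum_partialDeriv hv1 x (v t x)]
      simp only [WithLp.ofLp_sum, WithLp.ofLp_smul, Finset.sum_apply, Pi.smul_apply, smul_eq_mul]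
      refine Finset.sum_congr rfl fun j _ => ?_
      congr 1
      have h := FunctionSpaces.Torus.partialDeriv_clm_comp hvt' (EuclideanSpace.proj l : EuclideanSpace ℝ d →L[ℝ] ℝ) j x
      have hθ : ((EuclideanSpace.proj l : EuclideanSpace ℝ d →L[ℝ] ℝ) ∘ v t) = θ l t := by
        funext y; simp [hv_apply]
      rw [hθ] at h
      simpa using h.symm
    -- pressure gradient
    have h3 : FunctionSpaces.Torus.gradient (q t) x l = FunctionSpaces.Torus.partialDeriv l (q t) x :=
      gradient_coord (hqt.isContDiff (by simp)) x l
    -- fractional dissipation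
    have h4 : ν * fracLaplacian γ (v t) x l = (∑' m : d → ℤ, ((σ m : ℝ) : ℂ) * c t m l * mFourier m x).re := by
      rw [fracLaplacian_apply_eq_re_tsum hγ0 hvt' x l, ← Complex.re_ofReal_mul, ← tsum_mul_left]
      congr 1
      refine tsum_congr fun m => ?_
      rw [hcoefv t ht m l, hσ_def]
      push_cast
      ring
    rw [h1, h2, h3, h4]
    have h := hmom t ht x l
    simpa using h
  · -- incompressibility
    unfold FunctionSpaces.Torus.divergence
    have h : ∀ i, (fun y => v t y i) = θ i t := fun i => rfl
    simp_rw [h]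
    exact hdivθ t ht x
  · -- the datum
    funext x
    ext l
    rw [hv_apply]
    have hgl : FunctionSpaces.Torus.IsSmooth (fun y => ((u₀ y l : ℝ) : ℂ)) := (hu₀.apply l).comp_clm Complex.ofRealCLM
    have h1 : ((θ l 0 x : ℝ) : ℂ) = ((u₀ x l : ℝ) : ℂ) := by
      rw [hcoef 0 ⟨le_rfl, hT.le⟩ x l, hc0]
      have h2 : ∀ m, a m l = mFourierCoeff (fun y => ((u₀ y l : ℝ) : ℂ)) m := fun m => by
        rw [ha_def]
        exact mFourierCoeff_complexify_apply hu₀.integrable m l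
      simp_rw [h2]
      exact ScalarFourier.tsum_mFourierCoeff_mul_mFourier hgl.continuous
        (ScalarFourier.summable_norm_mFourierCoeff hgl) x
    exact_mod_cast h1

/-- **Short-time existence of smooth solutions of the fractional Navier–Stokes equations on `T³`**
(De Rosa 2019, §3.2, Thm. 3.4, existence for short times, by the energy method of Majda–Bertozzi
2002, Thm. 3.4; here with the life span expressed through the `C^{4,α}` norm of the datum, which
controls `‖u₀‖_{H⁴}`, `Torus.sum_weight_four_sq_norm_mFourierCoeff_le`): for `0 < α < 1`,
`0 < γ < 1`, `ν > 0` and `M > 0` there is `h > 0` such that every smooth FunctionSpaces.Torus.divergence-free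
`u₀ : T³ → ℝ³` with `‖u₀‖_{4+α} ≤ M` launches a smooth solution `(v, p)` of
`∂ₜv + (v·∇)v + ∇p + ν(-Δ)^γ v = 0`, `div v = 0` on `[0, h] × T³` with `v(0) = u₀` and
`∫ p(t) = 0` — the short-time existence hypothesis of `DeRosa.gluingStage_of_shortTime`.
[cite: Derosa2018, §3.2 Thm. 3.4; MajdaBertozziCUP2002, Thm. 3.4] -/
theorem fracNS_shortTime_smooth :
    ∀ α : ℝ, 0 < α → α < 1 → ∀ γ : ℝ, 0 < γ → γ < 1 → ∀ ν : ℝ, 0 < ν → ∀ M : ℝ, 0 < M →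
      ∃ h : ℝ, 0 < h ∧ ∀ u₀ : UnitAddTorus (Fin 3) → EuclideanSpace ℝ (Fin 3),
        FunctionSpaces.Torus.IsSmooth u₀ → FunctionSpaces.Torus.IsDivFree u₀ →
          FunctionSpaces.Torus.eContDiffHolderNorm 4 (Real.toNNReal α) u₀ ≤ ENNReal.ofReal M →
            ∃ (v : ℝ → UnitAddTorus (Fin 3) → EuclideanSpace ℝ (Fin 3)) (p : ℝ → UnitAddTorus (Fin 3) → ℝ),
              IsFracNSReynoldsOn (Icc 0 h) γ ν v p (fun _ _ _ => 0) ∧ v 0 = u₀ ∧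
                ∀ t ∈ Icc 0 h, FunctionSpaces.Torus.HasZeroMean (p t) := by
  intro α _hα hα1 γ hγ hγ1 ν hν M hM
  obtain ⟨B, hB⟩ := GalerkinSmooth.exists_latticeBound (d := Fin 3) (by simp)
  -- the constants: `M' = (C₃ M)²` bounds the `H⁴` sums, `Kd` is the life-span constant
  set C₃ : ℝ := (9 + (4 * Real.pi ^ 2)⁻¹ * Fintype.card (Fin 3)) ^ 2 with hC₃_def
  set M' : ℝ := (C₃ * M) ^ 2 with hM'_def
  set Kd : ℝ := ((Fintype.card (Fin 3) * (2 * (2 ^ 4 * (Fintype.card (Fin 3) * Real.sqrt B * (2 * Real.pi) ^ (2 * 4 + 1)))) *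
      (((Fintype.card (Fin 3) : ℝ) + 1) ^ 3 * Real.sqrt (((Fintype.card (Fin 3) : ℝ) + 1) ^ 3)) + 1) *
      Real.sqrt (1 + Fintype.card (Fin 3) * (2 * Real.pi) ^ (2 * 4))) with hKd_def
  have hB0 : 0 ≤ B := le_trans (Finset.sum_nonneg fun k _ => inv_nonneg.2 (sq_nonneg _)) (hB ∅)
  have hC₃ : 0 < C₃ := by rw [hC₃_def]; positivity
  have hCM : 0 < C₃ * M := mul_pos hC₃ hM
  have hM' : 0 < M' := by rw [hM'_def]; positivity
  have hKd : 0 ≤ Kd := by rw [hKd_def]; positivity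
  have hsqrt : Real.sqrt M' = C₃ * M := by rw [hM'_def, Real.sqrt_sq hCM.le]
  set h : ℝ := 1 / (Kd * (C₃ * M) + 1) with hh_def
  have hden : 0 < Kd * (C₃ * M) + 1 := by positivity
  have hh : 0 < h := by rw [hh_def]; positivity
  have hlife : h * (Kd * Real.sqrt M') ≤ 1 := by
    rw [hsqrt, hh_def, one_div, inv_mul_le_iff₀ hden]
    linarith
  refine ⟨h, hh, fun u₀ hu₀ hdiv hnorm => ?_⟩
  have hMu : ∀ S : Finset (Fin 3 → ℤ),
      ∑ k ∈ S, (1 + freqNormSq k) ^ 4 * ‖mFourierCoeff (EuclideanSpace.complexify ∘ u₀) k‖ ^ 2 ≤ M' := by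
    intro S
    have h1 := sum_weight_four_sq_norm_mFourierCoeff_le hu₀ (Real.toNNReal_le_one.2 hα1.le) hM.le hnorm S
    simpa [hM'_def, hC₃_def] using h1
  exact exists_fracNS_smooth_of_sobolevBound hB hγ.le hγ1.le hν.le hu₀ hdiv hM' hMu hh hlife

end Torus

/-! ## De Rosa's gluing stage -/

namespace DeRosa

/-- **De Rosa 2019, §5.2 (Cor. 5.2, Props. 5.3, 5.4, 5.5, with the local theory of §3.2,
Thm. 3.4 / Prop. 3.5): the gluing stage**, discharging the named fact `DeRosa.gluingStage`
(`DeRosaThreeStages.lean`). The tree reduces it to short-time existence of smooth solutions of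
the fractional Navier–Stokes equations (`DeRosa.gluingStage_of_shortTime`: exact solutions
launched from `v_ℓ(tᵢ)` on the life span `c/‖u₀‖_{1+α}` by the a priori estimate Prop. 3.5 and
continuation, their stability Cor. 5.2 / Prop. 5.3, the vector potentials of Prop. 5.4, the
partition of unity and the glued triple of Prop. 5.5 with the commutator estimate
`BDSV.commutatorCZBound_holds`), and short-time existence is `Torus.fracNS_shortTime_smooth`
(the Fourier–Galerkin energy method, Majda–Bertozzi 2002, Thm. 3.4).
[cite: Derosa2018, §5.2 Cor. 5.2, Props. 5.3–5.5; §3.2 Thm. 3.4, Prop. 3.5] -/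
theorem gluingStage_holds : gluingStage :=
  gluingStage_of_shortTime Torus.fracNS_shortTime_smooth

end DeRosa

end Literature.Analysis.FluidPDE
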